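import Summits.ABC.IUTFork.Joshi.TestGenuinePinsVacuityTame
import Summits.ABC.IUTFork.Thm311RealIsmDHMoverCensus
import Summits.ABC.IUTFork.Thm311RealIsmDHMoverDyadicComplete
import Summits.ABC.IUTFork.Thm311RealIsmDHMoverUnramifiedDyadic
import HarnessLib

/-!
# Branch E TEST — the RESIDUAL CLASS of the genuine-carrier pins (R-J row Y-26): the remaining per-place feeds
# (ramified places over `3` and `2` off the `(e, f) = (2, 1)` shapes, unramified dyadic places with `f ≥ 2`, torsion-free ramified places)

Proof-only sequel (abc-iut cell, D-0079 R-J «Joshi Y-discharge census», row Y-26; seat abc-iut-E-t43, gen 4; 0 definitions,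
no `Prop` fact, FACT rows used: none) to abc-iut-E-t44's `Joshi/TestGenuinePinsVacuity{,Tame,Ramified}.lean` (p445249 / p446217 /
p446474).  The row of record reads: the three region pins of [IUTchIII] Cor. 3.12, instantiated on the Dupuy–Hilado carriers
(`settingPrVolSharp` over `LatticeSituation.ofShells (logShellsDH X (analyticLogv F)) …`, abc-iut-c312-7), are KERNEL-UNINHABITED as soon
as `F` has ONE finite place `v₀` at which some element of Dupuy–Hilado's (Ind2) group moves the unit ball `𝒪_{v₀}` — fed so far at tame
odd places (p446217), at ramified places over `p ≥ 5` and at dyadic places of `F ∋ √−1` (p446474): «open only for `F` ramified inside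
`{2, 3}` without `√−1`».  THIS FILE feeds the remaining columns of TEAM R's mover census — abc-iut-w5-d039's
`exists_mem_ismDH_image_closedBall_one_ne_of_three` (`Thm311RealIsmDHMoverCensus`), abc-iut-c312-5's
`exists_mem_ismDH_image_closedBall_one_ne_of_dyadic_complete` (`…DyadicComplete`), abc-iut-w5-d180's
`exists_mem_ismDH_image_closedBall_ne_of_unramified_dyadic` (`…UnramifiedDyadic`) and abc-iut-w5-d039's volume constraint at `m = 0`
(`absRamificationIdx_eq_one_of_closedBall_one_eq_zpow_smul_logUnits`), all consumed BY NAME — through abc-iut-w5-d044's dictionary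
`exists_ismDH_image_integers_ne_of_image_closedBall_ne` into p446217's single-slot criterion
`not_pinnedRegions_settingPrVolSharp_of_exists_mover_anyPrime` (label `0`, NO hypothesis on the places of `S`).  Each result is a
`¬ Cor312Vol.PinnedRegions` / `¬ PinnedRegions3` theorem at `settingPrVolSharp` for the analytic logarithms, EVERY `X : PilotData F`, `ρ`,
`qK`, column data, `Ψ`, ideles, column:

* `not_pinnedRegions(3)_settingPrVolSharp_of_three_anyPrime` — ONE place `v₀ ∣ 3` with `e(v₀|3) ≥ 2`, `(e, f) ≠ (2, 1)`;
* `not_pinnedRegions(3)_settingPrVolSharp_of_dyadic_complete_anyPrime` — ONE place `v₀ ∣ 2` with `e(v₀|2) ≥ 2`, `(e, f) ≠ (2, 1)`;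
* `not_pinnedRegions(3)_settingPrVolSharp_of_unramified_dyadic_anyPrime` — ONE place `v₀ ∣ 2` with `e(v₀|2) = 1`, `f(v₀|2) ≥ 2`;
* `not_pinnedRegions(3)_settingPrVolSharp_of_torsionPExp_eq_zero_anyPrime` — ONE place `v₀ ∣ p` with `e(v₀|p) ≥ 2` and no `p`-power
  roots of unity in `F_{v₀}` (e.g. the `ℚ_3(√3)`-shape, `TestGenuinePinsResidueDegreeOne`).

CONSEQUENCE FOR THE RECORD (tree currency, no side taken): with p446217 / p446474 the Y-26 obstruction of record is now fed at EVERY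
finite place whose completion is NOT one of — unramified over an odd prime; `ℚ_2`; the `ℚ_3(ζ_3)`-shape `(e, f, m) = (2, 1, 1)`; the
`(e, f) = (2, 1)` dyadic shapes with the unit ball fixed (`ℚ_2(√3)`-type, abc-iut-w4-d017) — i.e. the residual class of row Y-26 is
«EVERY completion of `F` has `𝒪_v = p^k·log_p(𝒪_v^×)`» (abc-iut-w5-d180's ball-mover criterion read place by place); the global
corollaries (every `F ∋ √d` with `d ≡ 5 (mod 8)`, in particular every `F ∋ ζ_3`; every `F ∋ √d` with a prime `q ≥ 5`, `q ∥ d`; every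
quadratic field) are `TestGenuinePinsVacuityQuadratic`.  HONEST SCOPE: OUR interface, OUR sharp real container, Dupuy–Hilado's
reading of (Ind2); nothing here bears on print's (xi-e)/(xi-f); locates / conditionally verifies; no abc claim.
[claim: Mochizuki2012, status: disputed] [cite: DupuyHilado2025, §4.9] [cite: NeukirchANT1999, Ch. II Prop. (5.7)]
-/

noncomputable section

open Set Function NumberField IsDedekindDomain Metric
open scoped Pointwise

namespace Summit.ABC.IUTFork.Joshi

open Thm311 Thm311.Real Cor312 Cor312Vol Literature.IUT.LogThetaLattice Literature.IUT.LogVolume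
  Literature.IUT.HodgeTheaters Literature.NumberTheory.NumberFields
open Literature.NumberTheory.GaloisRepresentations.Ultrametric



/-! ## The per-place feeds at `settingPrVolSharp` -/

variable {F : Type} [Field F] [NumberField F] (X : PilotData F)
  (M : Type) [Field M] [NumberField M]
  (archPk : ∀ (j : (thetaIndex X).Label) (vQ : (thetaIndex X).VQ), Set ((logShellsDH X (analyticLogv F)).Packet j vQ))
  (archSub : ∀ (j : (thetaIndex X).Label) (v : (thetaIndex X).V),
    Set ((logShellsDH X (analyticLogv F)).Packet j ((thetaIndex X).over v)))
  (Ψ : ℤ → ∀ v : (thetaIndex X).V, v ∈ (thetaIndex X).Vbad → Set ((logShellsDH X (analyticLogv F)).StarPacket v))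
  (act : ℤ → ∀ v : (thetaIndex X).V, v ∈ (thetaIndex X).Vbad →
    (logShellsDH X (analyticLogv F)).StarPacket v → Module.End ℚ ((logShellsDH X (analyticLogv F)).StarPacket v))
  (Mmod : ℤ → ∀ j : (thetaIndex X).LabelStar, Set ((logShellsDH X (analyticLogv F)).GlobalPacket j.1))
  (region : ℤ → ∀ j : (thetaIndex X).LabelStar, FinDivisor M → ∀ vQ : (thetaIndex X).VQ,
    Set ((logShellsDH X (analyticLogv F)).Packet j.1 vQ))
  (frobAdm : ℤ → ℤ → ∀ (j : (thetaIndex X).Label) (vQ : (thetaIndex X).VQ),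
    Set ((logShellsDH X (analyticLogv F)).Packet j vQ) → Prop)
  (frobLogvol : ℤ → ℤ → ∀ (j : (thetaIndex X).Label) (vQ : (thetaIndex X).VQ),
    Set ((logShellsDH X (analyticLogv F)).Packet j vQ) → ℝ)
  (frobΨ : ℤ → ℤ → ∀ v : (thetaIndex X).V, v ∈ (thetaIndex X).Vbad → Set ((logShellsDH X (analyticLogv F)).StarPacket v))
  (frobMmod : ℤ → ℤ → ∀ j : (thetaIndex X).LabelStar, Set ((logShellsDH X (analyticLogv F)).GlobalPacket j.1))
  (unitImage : ℤ → ℤ → ℕ → ∀ (j : (thetaIndex X).Label) (vQ : (thetaIndex X).VQ),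
    Set ((logShellsDH X (analyticLogv F)).Packet j vQ))
  (ballImage : ℤ → ℤ → ∀ (j : (thetaIndex X).Label) (vQ : (thetaIndex X).VQ),
    Set ((logShellsDH X (analyticLogv F)).Packet j vQ))
  (thetaDiv : ℤ → ℤ → LgpDivisor M (thetaIndex X).lstar)
  (n : ℤ) {HT : Type} {LogLink : HT → HT → Type} {IsFull : ∀ {s t : HT}, LogLink s t → Prop}
  (lat : LGPGaussianLogThetaLattice LogLink IsFull)
  {Frd : Type} {IsoF : Frd → Frd → Type} {Ob : Frd → Type} {realify : Frd → Frd} {Strip : Type}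
  {IsoS : Strip → Strip → Type} {Mv : ∀ v : (thetaIndex X).V, v ∈ (thetaIndex X).Vbad → Type}
  [∀ v h, Monoid (Mv v h)]
  (sig : GlobalLGPFrobenioidSignature (thetaIndex X).lstar (thetaIndex X).V (· ∈ (thetaIndex X).Vbad)
    Frd IsoF Ob realify Strip IsoS Mv)
  (split : SplittingMonoids Mv) {ObΔ : Type} {N : ∀ v : (thetaIndex X).V, v ∈ (thetaIndex X).Vbad → Type}
  [∀ v h, Monoid (N v h)] (qData : QPilotData ObΔ N)
  (t : ∀ (pp : Nat.Primes) (_ : Fin X.lstar) (x : (thetaIndex X).Fibre (.inr pp)),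
    haveI : Fact (pp : ℕ).Prime := ⟨pp.2⟩; kOf X pp.1 x)
  (tq : ∀ (pp : Nat.Primes) (x : (thetaIndex X).Fibre (.inr pp)), haveI : Fact (pp : ℕ).Prime := ⟨pp.2⟩; kOf X pp.1 x)
  (ρ : (∀ v : (thetaIndex X).V, v ∈ (thetaIndex X).Vbad → Set ((logShellsDH X (analyticLogv F)).StarPacket v)) →
    ∀ (j : (thetaIndex X).Label) (vQ : (thetaIndex X).VQ), Set ((logShellsDH X (analyticLogv F)).Packet j vQ))
  (qK : ∀ v : (thetaIndex X).V, v ∈ (thetaIndex X).Vbad → Set ((logShellsDH X (analyticLogv F)).StarPacket v))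
  (htq0 : ∀ pp x, tq pp x ≠ 0)
  (htq1 : ∀ (pp : Nat.Primes) (x : (thetaIndex X).Fibre (.inr pp)),
    haveI : Fact (pp : ℕ).Prime := ⟨pp.2⟩; placeOf X pp.1 x ∉ X.S → ‖tq pp x‖ = 1)

/-- **A PLACE OVER `3` WITH `e(v₀|3) ≥ 2`, `(e, f) ≠ (2, 1)` (bad places over `3` allowed): `PinnedRegions` FAILS at
`settingPrVolSharp`** for the analytic logarithms — every `X : PilotData F`, `ρ`, `qK`, column data, `Ψ`, ideles, column. Mover:
abc-iut-w5-d039's `exists_mem_ismDH_image_closedBall_one_ne_of_three`. [cite: DupuyHilado2025, §4.9] [claim: Mochizuki2012, status: disputed] -/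
theorem not_pinnedRegions_settingPrVolSharp_of_three_anyPrime (v₀ : HeightOneSpectrum (𝓞 F))
    (hv₀ : (thetaIndex X).over (.inr v₀) = .inr ⟨3, Nat.prime_three⟩) (he2 : 2 ≤ v₀.asIdeal.ramificationIdx ℤ)
    (hne : ¬ (v₀.asIdeal.ramificationIdx ℤ = 2 ∧ v₀.asIdeal.inertiaDeg ℤ = 1)) :
    ¬ Cor312Vol.PinnedRegions
      (LatticeSituation.ofShells (logShellsDH X (analyticLogv F)) M archPk archSub
        (summandPiecesPr X (logvAnalytic_analyticLogv (F := F))).Adm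
        (summandPiecesPr X (logvAnalytic_analyticLogv (F := F))).logvol Ψ act Mmod region frobAdm frobLogvol frobΨ frobMmod
        unitImage ballImage thetaDiv)
      (settingPrVolSharp X (logvAnalytic_analyticLogv (F := F)) M archPk archSub Ψ act Mmod region n lat sig split qData tq t
        htq0 htq1) ρ qK :=
  haveI : Fact (Nat.Prime 3) := ⟨Nat.prime_three⟩
  not_pinnedRegions_settingPrVolSharp_of_exists_mover_anyPrime X M archPk archSub Ψ act Mmod region frobAdm frobLogvol frobΨ
    frobMmod unitImage ballImage thetaDiv n lat sig split qData t tq ρ qK htq0 htq1 ⟨3, Nat.prime_three⟩ v₀ hv₀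
    (exists_ismDH_image_integers_ne_of_image_closedBall_ne ⟨3, Nat.prime_three⟩ v₀
      (natCast_mem_placeOf X (⟨3, Nat.prime_three⟩ : Nat.Primes) ⟨.inr v₀, hv₀⟩)
      (exists_mem_ismDH_image_closedBall_one_ne_of_three (logvAnalyticAt_analyticLogv (F := F) 3) v₀ _ rfl he2 hne))

/-- The same for `PinnedRegions3`. [claim: Mochizuki2012, status: disputed] -/
theorem not_pinnedRegions3_settingPrVolSharp_of_three_anyPrime (v₀ : HeightOneSpectrum (𝓞 F))
    (hv₀ : (thetaIndex X).over (.inr v₀) = .inr ⟨3, Nat.prime_three⟩) (he2 : 2 ≤ v₀.asIdeal.ramificationIdx ℤ)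
    (hne : ¬ (v₀.asIdeal.ramificationIdx ℤ = 2 ∧ v₀.asIdeal.inertiaDeg ℤ = 1)) :
    ¬ Cor312Vol.PinnedRegions3
      (LatticeSituation.ofShells (logShellsDH X (analyticLogv F)) M archPk archSub
        (summandPiecesPr X (logvAnalytic_analyticLogv (F := F))).Adm
        (summandPiecesPr X (logvAnalytic_analyticLogv (F := F))).logvol Ψ act Mmod region frobAdm frobLogvol frobΨ frobMmod
        unitImage ballImage thetaDiv)
      (settingPrVolSharp X (logvAnalytic_analyticLogv (F := F)) M archPk archSub Ψ act Mmod region n lat sig split qData tq t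
        htq0 htq1) ρ qK :=
  fun h => not_pinnedRegions_settingPrVolSharp_of_three_anyPrime X M archPk archSub Ψ act Mmod region frobAdm frobLogvol
    frobΨ frobMmod unitImage ballImage thetaDiv n lat sig split qData t tq ρ qK htq0 htq1 v₀ hv₀ he2 hne h.1

/-- **A RAMIFIED PLACE OVER `2` WITH `(e, f) ≠ (2, 1)` (bad places over `2` allowed; no `√−1` needed): `PinnedRegions` FAILS
at `settingPrVolSharp`** for the analytic logarithms. Mover: abc-iut-c312-5's
`exists_mem_ismDH_image_closedBall_one_ne_of_dyadic_complete`. [cite: DupuyHilado2025, §4.9] [claim: Mochizuki2012, status: disputed] -/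
theorem not_pinnedRegions_settingPrVolSharp_of_dyadic_complete_anyPrime (v₀ : HeightOneSpectrum (𝓞 F))
    (hv₀ : (thetaIndex X).over (.inr v₀) = .inr ⟨2, Nat.prime_two⟩) (he2 : 2 ≤ v₀.asIdeal.ramificationIdx ℤ)
    (hne : ¬ (v₀.asIdeal.ramificationIdx ℤ = 2 ∧ v₀.asIdeal.inertiaDeg ℤ = 1)) :
    ¬ Cor312Vol.PinnedRegions
      (LatticeSituation.ofShells (logShellsDH X (analyticLogv F)) M archPk archSub
        (summandPiecesPr X (logvAnalytic_analyticLogv (F := F))).Adm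
        (summandPiecesPr X (logvAnalytic_analyticLogv (F := F))).logvol Ψ act Mmod region frobAdm frobLogvol frobΨ frobMmod
        unitImage ballImage thetaDiv)
      (settingPrVolSharp X (logvAnalytic_analyticLogv (F := F)) M archPk archSub Ψ act Mmod region n lat sig split qData tq t
        htq0 htq1) ρ qK :=
  haveI : Fact (Nat.Prime 2) := ⟨Nat.prime_two⟩
  not_pinnedRegions_settingPrVolSharp_of_exists_mover_anyPrime X M archPk archSub Ψ act Mmod region frobAdm frobLogvol frobΨ
    frobMmod unitImage ballImage thetaDiv n lat sig split qData t tq ρ qK htq0 htq1 ⟨2, Nat.prime_two⟩ v₀ hv₀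
    (exists_ismDH_image_integers_ne_of_image_closedBall_ne ⟨2, Nat.prime_two⟩ v₀
      (natCast_mem_placeOf X (⟨2, Nat.prime_two⟩ : Nat.Primes) ⟨.inr v₀, hv₀⟩)
      (exists_mem_ismDH_image_closedBall_one_ne_of_dyadic_complete (logvAnalyticAt_analyticLogv (F := F) 2) v₀ _ he2 hne))

/-- The same for `PinnedRegions3`. [claim: Mochizuki2012, status: disputed] -/
theorem not_pinnedRegions3_settingPrVolSharp_of_dyadic_complete_anyPrime (v₀ : HeightOneSpectrum (𝓞 F))
    (hv₀ : (thetaIndex X).over (.inr v₀) = .inr ⟨2, Nat.prime_two⟩) (he2 : 2 ≤ v₀.asIdeal.ramificationIdx ℤ)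
    (hne : ¬ (v₀.asIdeal.ramificationIdx ℤ = 2 ∧ v₀.asIdeal.inertiaDeg ℤ = 1)) :
    ¬ Cor312Vol.PinnedRegions3
      (LatticeSituation.ofShells (logShellsDH X (analyticLogv F)) M archPk archSub
        (summandPiecesPr X (logvAnalytic_analyticLogv (F := F))).Adm
        (summandPiecesPr X (logvAnalytic_analyticLogv (F := F))).logvol Ψ act Mmod region frobAdm frobLogvol frobΨ frobMmod
        unitImage ballImage thetaDiv)
      (settingPrVolSharp X (logvAnalytic_analyticLogv (F := F)) M archPk archSub Ψ act Mmod region n lat sig split qData tq t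
        htq0 htq1) ρ qK :=
  fun h => not_pinnedRegions_settingPrVolSharp_of_dyadic_complete_anyPrime X M archPk archSub Ψ act Mmod region frobAdm
    frobLogvol frobΨ frobMmod unitImage ballImage thetaDiv n lat sig split qData t tq ρ qK htq0 htq1 v₀ hv₀ he2 hne h.1

/-- **AN UNRAMIFIED PLACE OVER `2` OF RESIDUE DEGREE `≥ 2`** (e.g. `2` inert in a quadratic subfield; bad places over `2` allowed):
**`PinnedRegions` FAILS at `settingPrVolSharp`** for the analytic logarithms. Mover: abc-iut-w5-d180's
`exists_mem_ismDH_image_closedBall_ne_of_unramified_dyadic` at `t = 1`. [cite: DupuyHilado2025, §4.9] [claim: Mochizuki2012, status: disputed] -/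
theorem not_pinnedRegions_settingPrVolSharp_of_unramified_dyadic_anyPrime (v₀ : HeightOneSpectrum (𝓞 F))
    (hv₀ : (thetaIndex X).over (.inr v₀) = .inr ⟨2, Nat.prime_two⟩) (he : v₀.asIdeal.ramificationIdx ℤ = 1)
    (hf : 2 ≤ v₀.asIdeal.inertiaDeg ℤ) :
    ¬ Cor312Vol.PinnedRegions
      (LatticeSituation.ofShells (logShellsDH X (analyticLogv F)) M archPk archSub
        (summandPiecesPr X (logvAnalytic_analyticLogv (F := F))).Adm
        (summandPiecesPr X (logvAnalytic_analyticLogv (F := F))).logvol Ψ act Mmod region frobAdm frobLogvol frobΨ frobMmod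
        unitImage ballImage thetaDiv)
      (settingPrVolSharp X (logvAnalytic_analyticLogv (F := F)) M archPk archSub Ψ act Mmod region n lat sig split qData tq t
        htq0 htq1) ρ qK := by
  haveI : Fact (Nat.Prime 2) := ⟨Nat.prime_two⟩
  have hv : ((2 : ℕ) : 𝓞 F) ∈ v₀.asIdeal := natCast_mem_placeOf X (⟨2, Nat.prime_two⟩ : Nat.Primes) ⟨.inr v₀, hv₀⟩
  have hmov := exists_mem_ismDH_image_closedBall_ne_of_unramified_dyadic (logvAnalyticAt_analyticLogv (F := F) 2) v₀ hv he hf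
    (one_ne_zero : (1 : RescaledCompletion F 2 v₀ hv) ≠ 0)
  rw [norm_one] at hmov
  exact not_pinnedRegions_settingPrVolSharp_of_exists_mover_anyPrime X M archPk archSub Ψ act Mmod region frobAdm frobLogvol frobΨ
    frobMmod unitImage ballImage thetaDiv n lat sig split qData t tq ρ qK htq0 htq1 ⟨2, Nat.prime_two⟩ v₀ hv₀
    (exists_ismDH_image_integers_ne_of_image_closedBall_ne ⟨2, Nat.prime_two⟩ v₀ hv hmov)

/-- The same for `PinnedRegions3`. [claim: Mochizuki2012, status: disputed] -/
theorem not_pinnedRegions3_settingPrVolSharp_of_unramified_dyadic_anyPrime (v₀ : HeightOneSpectrum (𝓞 F))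
    (hv₀ : (thetaIndex X).over (.inr v₀) = .inr ⟨2, Nat.prime_two⟩) (he : v₀.asIdeal.ramificationIdx ℤ = 1)
    (hf : 2 ≤ v₀.asIdeal.inertiaDeg ℤ) :
    ¬ Cor312Vol.PinnedRegions3
      (LatticeSituation.ofShells (logShellsDH X (analyticLogv F)) M archPk archSub
        (summandPiecesPr X (logvAnalytic_analyticLogv (F := F))).Adm
        (summandPiecesPr X (logvAnalytic_analyticLogv (F := F))).logvol Ψ act Mmod region frobAdm frobLogvol frobΨ frobMmod
        unitImage ballImage thetaDiv)
      (settingPrVolSharp X (logvAnalytic_analyticLogv (F := F)) M archPk archSub Ψ act Mmod region n lat sig split qData tq t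
        htq0 htq1) ρ qK :=
  fun h => not_pinnedRegions_settingPrVolSharp_of_unramified_dyadic_anyPrime X M archPk archSub Ψ act Mmod region frobAdm
    frobLogvol frobΨ frobMmod unitImage ballImage thetaDiv n lat sig split qData t tq ρ qK htq0 htq1 v₀ hv₀ he hf h.1

/-- **A RAMIFIED PLACE OVER ANY PRIME WITHOUT `p`-POWER ROOTS OF UNITY** (`e(v₀|p) ≥ 2`, `torsionPExp p F_{v₀} = 0` — wild
ramification allowed, e.g. the `ℚ_3(√3)`-shape over `3`; bad places allowed): **`PinnedRegions` FAILS at `settingPrVolSharp`** for the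
analytic logarithms (abc-iut-w5-d039's volume constraint at `m = 0` forces `e = 1` when the unit ball is a `p^k·log_p(𝒪^×)`).
[cite: DupuyHilado2025, §4.9] [cite: NeukirchANT1999, Ch. II Prop. (5.7)] [claim: Mochizuki2012, status: disputed] -/
theorem not_pinnedRegions_settingPrVolSharp_of_torsionPExp_eq_zero_anyPrime (pp : Nat.Primes) (v₀ : HeightOneSpectrum (𝓞 F))
    (hv₀ : (thetaIndex X).over (.inr v₀) = .inr pp) (hv : ((pp : ℕ) : 𝓞 F) ∈ v₀.asIdeal) (he2 : 2 ≤ v₀.asIdeal.ramificationIdx ℤ)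
    (hm : haveI : Fact (pp : ℕ).Prime := ⟨pp.2⟩; torsionPExp pp (RescaledCompletion F pp v₀ hv) = 0) :
    ¬ Cor312Vol.PinnedRegions
      (LatticeSituation.ofShells (logShellsDH X (analyticLogv F)) M archPk archSub
        (summandPiecesPr X (logvAnalytic_analyticLogv (F := F))).Adm
        (summandPiecesPr X (logvAnalytic_analyticLogv (F := F))).logvol Ψ act Mmod region frobAdm frobLogvol frobΨ frobMmod
        unitImage ballImage thetaDiv)
      (settingPrVolSharp X (logvAnalytic_analyticLogv (F := F)) M archPk archSub Ψ act Mmod region n lat sig split qData tq t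
        htq0 htq1) ρ qK := by
  haveI : Fact (pp : ℕ).Prime := ⟨pp.2⟩
  refine not_pinnedRegions_settingPrVolSharp_of_forall_ne_anyPrime X M archPk archSub Ψ act Mmod region frobAdm frobLogvol frobΨ
    frobMmod unitImage ballImage thetaDiv n lat sig split qData t tq ρ qK htq0 htq1 pp v₀ hv₀ hv fun k hk => ?_
  have h1 := (absRamificationIdx_eq_one_of_closedBall_one_eq_zpow_smul_logUnits pp (RescaledCompletion F pp v₀ hv) hm hk).1
  rw [absRamificationIdx_rescaledCompletion F pp v₀ hv] at h1
  omega

/-- The same for `PinnedRegions3`. [claim: Mochizuki2012, status: disputed] -/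
theorem not_pinnedRegions3_settingPrVolSharp_of_torsionPExp_eq_zero_anyPrime (pp : Nat.Primes) (v₀ : HeightOneSpectrum (𝓞 F))
    (hv₀ : (thetaIndex X).over (.inr v₀) = .inr pp) (hv : ((pp : ℕ) : 𝓞 F) ∈ v₀.asIdeal) (he2 : 2 ≤ v₀.asIdeal.ramificationIdx ℤ)
    (hm : haveI : Fact (pp : ℕ).Prime := ⟨pp.2⟩; torsionPExp pp (RescaledCompletion F pp v₀ hv) = 0) :
    ¬ Cor312Vol.PinnedRegions3
      (LatticeSituation.ofShells (logShellsDH X (analyticLogv F)) M archPk archSub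
        (summandPiecesPr X (logvAnalytic_analyticLogv (F := F))).Adm
        (summandPiecesPr X (logvAnalytic_analyticLogv (F := F))).logvol Ψ act Mmod region frobAdm frobLogvol frobΨ frobMmod
        unitImage ballImage thetaDiv)
      (settingPrVolSharp X (logvAnalytic_analyticLogv (F := F)) M archPk archSub Ψ act Mmod region n lat sig split qData tq t
        htq0 htq1) ρ qK :=
  fun h => not_pinnedRegions_settingPrVolSharp_of_torsionPExp_eq_zero_anyPrime X M archPk archSub Ψ act Mmod region frobAdm
    frobLogvol frobΨ frobMmod unitImage ballImage thetaDiv n lat sig split qData t tq ρ qK htq0 htq1 pp v₀ hv₀ hv he2 hm h.1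

end Summit.ABC.IUTFork.Joshi

end
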